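import Summits.Ventures.LatticeQCDFlow.Scaling.BooleanStarOneCopyToolkit

/-!
HONEST FRAMING: exact (Metropolis-corrected) sampling algorithms for lattice gauge theory; figures
of merit are autocorrelation/cost numbers at stated couplings and volumes; no continuum-physics
claim.

# BooleanStarDriftPotential — PLAN A FOR THE LAST CORNER OF OPEN-MATH ITEM 1 (ii) ON THE HOMOGENEOUS BOOLEAN STAR, STRUCTURAL HALF, TYPED: A CONVEX POTENTIAL
# WHOSE CURVATURE IS PRESCRIBED BY THE ONE-COPY DRIFT PAYS FOR IT OUT OF THE COUPLING BRACKET, AND THE DRIFT INEQUALITY OF S9 REDUCES TO TWO PER-COUNT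
# CONDITIONS ON THE DRIFT ALONE (lean-2 GEN-32, ours)

Venture-side (OURS).  Cell `lqcd-flow` (pub-lqcd), unit `pub-lqcd-lean-2-g32`, 2026-08-29.  Chapter S, file 12, on top of `BooleanStarOneCopyToolkit` (S11).  Abstract
one-dimensional setting on an integer window `[lo, hi]` (to be instantiated with S11's one-copy drift `m = μ̄π_b̄ − μπ_b` of the homogeneous Boolean star, its
gaps `g(B) = m(B) − m(B+1)`, step masses `q↓ = μπ_b`, `q↑ = μ̄π_b̄` and a potential `φ` on the integers admitted by `boolStar_mixingTime_le_of_oneCopyDrift_int`):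
step masses with `q↓ + q↑ ≤ 1` and `q↓ − q↑ = −m`, gaps `≥ 0` and non-increasing, a bottom `B₀` (`m ≥ 0` at and below, `m ≤ 0` above); a CONVEX potential, flat at the
bottom (`S(B₀) = 0`, `S(B) = φ(B+1) − φ(B)` non-decreasing), whose second differences obey `S(B) − S(B−1) ≤ λg(B) + 2λ|m(B)|·min{|S(B−1)|, |S(B)|}` — the local gap
plus a self-financed part (memo `lean-2/MEMO-gen32-certificate-largeK.md` §20: the recursive choice with equality and the cap `S ≤ 1` passes the 1-D numerics with
`κ ≈ 1.6–2.4`, `numerics/one_dim_planA.py`).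

* §4 `int_chain_le`, **`oneCopy_curvature_le_bracket`**: `[m(B₁) − m(B₂)] + d(B₁) + d(B₂) ≥ (1−λ)[m(B₁) − m(B₂)] + (1−θ)(|m(B₁)||s̄(B₁)| + |m(B₂)||s̄(B₂)|)` for
  `lo ≤ B₁ < B₂ ≤ hi` — by the three-point identity the curvature costs at most `(λ/2)(g(B₁)+g(B₂)) + θΣ|m s̄|`, and the bracket `Σ_{B₁≤j<B₂} g(j)` contains `g(B₁)` and
  `g(B₂−1) ≥ g(B₂)`.
* §5 `int_gap_sum_ge`, **`oneCopyDrift_of_driftPotential`**: with `φ(B₀) = 0`, if (D1) `2ρ|B − B*| ≤ (1−λ)|m(B)|` on the window for some `B* ∈ [B₀, B₀+1]` (the drift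
  grows at least linearly away from its real zero) and (D2) `ρ(1 − S(B−1)) ≤ (1−λ)g(B)` above the bottom, `ρ(1 + S(B−1)) ≤ (1−λ)g(B−1)` at and below it (wherever the slope
  is unsaturated the local gap is
  still `≳ ρ`), then **`ρ((B₂ − B₁) + φ(B₁) + φ(B₂)) ≤ [m(B₁) − m(B₂)] + d(B₁) + d(B₂)`** for all `lo ≤ B₁ < B₂ ≤ hi` — which is the drift inequality of S9
  (`oneCopy_bracket_eq_drift_sub`).  Straddling pairs use (D1) only (`φ(B) ≤ |B − B*|·|s̄(B)|` by convexity); same-side pairs use (D2) at the far copy together with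
  `Σ g ≥ (B₂−B₁)·g(B₂−1)`.

What is left for the corner `t ≫ h`, `rr ≪ μ_0(b)`, `μ_0(b̄)rrK ≳ μ_0(b)`: exhibit the recursive `φ` (cap `S ≤ 1`) and verify (D1), (D2) for S11's explicit `m`, `g` — real
inequalities on the closed forms (`|m(B)| ≥ |B − B*|·g(max{B, B₀})` from S11, `|m(B)| ≥ μcB/(2Δ(B))` beyond `≈ 2μ̄rrK/μ`, and the growth of `S` to `1` before `g` drops
below `ρ`; memo §20–§21).  With the recursive `φ` of the memo the sufficient conditions (D1), (D2) hold numerically with `κ ≈ 0.4–0.6` in units `μ_0(b)c/(h+2t)`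
(`numerics/one_dim_D1D2.py`; binding: (D1) at `B = K`; (D2) has slack `≥ 1.2`), uniformly for `K ≤ 1600`, `μ_0(b) ∈ [0.05, 0.8]`.  NOT CLAIMED: (D1), (D2) for the
explicit chain; anything measured.  Literature grade (cell rule): OWN, elementary; nothing cited as a fact; no new bib keys.
-/

noncomputable section

namespace Summit.Ventures.LatticeQCDFlow.Scaling

/-! ## §4 Curvature financed by the bracket, and the per-copy form of the drift inequality (the structural half of Plan A, memo §20) -/

/-- Chains of a non-increasing integer sequence on a window: `f(B') ≤ f(B)` for `lo ≤ B ≤ B' ≤ hi + 1` from the one-step hypothesis on `[lo, hi]`. [ours] -/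
theorem int_chain_le {f : ℤ → ℝ} {lo hi : ℤ} (hf : ∀ B, lo ≤ B → B ≤ hi → f (B + 1) ≤ f B) {B B' : ℤ} (hlo : lo ≤ B) (hBB : B ≤ B') (hhi : B' ≤ hi + 1) :
    f B' ≤ f B := by
  obtain ⟨n, rfl⟩ : ∃ n : ℕ, B' = B + n := ⟨(B' - B).toNat, by rw [Int.toNat_of_nonneg (by linarith)]; ring⟩
  induction n with
  | zero => simp
  | succ k ih =>
    have hk : B + (k : ℕ) ≤ hi + 1 := by push_cast at hhi ⊢; linarith
    have := ih (by linarith) hk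
    have step := hf (B + k) (by linarith) (by push_cast at hhi; linarith)
    push_cast at this step ⊢
    rw [show B + ((k : ℤ) + 1) = B + k + 1 by ring]
    linarith

/-- **A CONVEX POTENTIAL WHOSE CURVATURE IS PRESCRIBED BY THE DRIFT PAYS FOR IT OUT OF THE COUPLING BRACKET.**  Abstract one-dimensional setting on the integer window
`[lo, hi]`: step masses with `q↓ + q↑ ≤ 1`, drift `m` with `q↓ − q↑ = −m`, gaps `g(B) = m(B) − m(B+1) ≥ 0` non-increasing, a bottom `B₀` with `m ≥ 0` on `B ≤ B₀` and
`m ≤ 0` on `B ≥ B₀+1`; a potential with forward slopes `S(B) = φ(B+1) − φ(B)`, CONVEX (`S` non-decreasing), flat at the bottom (`S(B₀) = 0`), and curvature bounded by the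
local gap plus a self-financed part: `S(B) − S(B−1) ≤ λ·g(B) + 2θ·|m(B)|·min{|S(B−1)|, |S(B)|}`.  Then for the drift term `d(B) = q↓(B)S(B−1) − q↑(B)S(B)` and all
`lo ≤ B₁ < B₂ ≤ hi`: **`[m(B₁) − m(B₂)] + d(B₁) + d(B₂) ≥ (1−λ)[m(B₁) − m(B₂)] + (1−θ)(|m(B₁)|·|s̄(B₁)| + |m(B₂)|·|s̄(B₂)|)`**, `s̄(B) = (S(B−1) + S(B))/2` (`λ, θ ≥ 0`):
by the three-point identity the curvature costs at most `(λ/2)(g(B₁) + g(B₂)) + θ(|m s̄|₁ + |m s̄|₂)`, and the bracket `Σ_{B₁≤j<B₂} g(j)` contains `g(B₁)` and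
`g(B₂−1) ≥ g(B₂)`. [ours] -/
theorem oneCopy_curvature_le_bracket {m qd qu S : ℤ → ℝ} {B₀ lo hi : ℤ} {lam θ : ℝ} (hlam0 : 0 ≤ lam) (hθ : 0 ≤ θ)
    (hq : ∀ B, qd B - qu B = -m B) (hq1 : ∀ B, qd B + qu B ≤ 1)
    (hg0 : ∀ B, lo ≤ B → B ≤ hi → m (B + 1) ≤ m B)
    (hga : ∀ B, lo ≤ B → B + 1 ≤ hi → m (B + 1) - m (B + 1 + 1) ≤ m B - m (B + 1))
    (hpos : ∀ B, B ≤ B₀ → 0 ≤ m B) (hneg : ∀ B, B₀ + 1 ≤ B → m B ≤ 0)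
    (hS0 : S B₀ = 0) (hSmono : ∀ B, S (B - 1) ≤ S B)
    (hcurv : ∀ B, lo ≤ B → B ≤ hi → S B - S (B - 1) ≤ lam * (m B - m (B + 1)) + 2 * θ * |m B| * min |S (B - 1)| |S B|)
    (B₁ B₂ : ℤ) (hlo : lo ≤ B₁) (h12 : B₁ < B₂) (hhi : B₂ ≤ hi) :
    (1 - lam) * (m B₁ - m B₂) + (1 - θ) * (|m B₁| * |(S (B₁ - 1) + S B₁) / 2| + |m B₂| * |(S (B₂ - 1) + S B₂) / 2|)
      ≤ (m B₁ - m B₂) + (qd B₁ * S (B₁ - 1) - qu B₁ * S B₁) + (qd B₂ * S (B₂ - 1) - qu B₂ * S B₂) := by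
  have hSmono' : Monotone S := monotone_int_of_le_succ (fun B => by simpa using hSmono (B + 1))
  -- signs of the slopes: `S ≥ 0` at and above `B₀`, `S ≤ 0` at and below
  have Sge : ∀ B, B₀ ≤ B → 0 ≤ S B := fun B hB => by rw [← hS0]; exact hSmono' hB
  have Sle : ∀ B, B ≤ B₀ → S B ≤ 0 := fun B hB => by rw [← hS0]; exact hSmono' hB
  -- the pointwise bound `d(B) ≥ (1 − θ)|m||s̄| − (λ/2)·g(B)` on the window
  have point : ∀ B, lo ≤ B → B ≤ hi → (1 - θ) * (|m B| * |(S (B - 1) + S B) / 2|) - lam / 2 * (m B - m (B + 1))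
      ≤ qd B * S (B - 1) - qu B * S B := by
    intro B hBlo hBhi
    have three := oneCopy_threePoint (qd B) (qu B) (S (B - 1)) (S B)
    have hk0 : 0 ≤ S B - S (B - 1) := by linarith [hSmono B]
    have hQ : (qd B + qu B) * ((S B - S (B - 1)) / 2) ≤ (S B - S (B - 1)) / 2 := by
      have := mul_le_mul_of_nonneg_right (hq1 B) (by linarith : 0 ≤ (S B - S (B - 1)) / 2); linarith
    have key : -m B * ((S B + S (B - 1)) / 2) = |m B| * |(S (B - 1) + S B) / 2|
        ∧ min |S (B - 1)| |S B| ≤ |(S (B - 1) + S B) / 2| := by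
      rcases le_or_gt B B₀ with hB | hB
      · have m0 := hpos B hB
        have s1 := Sle B hB
        have s0 := Sle (B - 1) (by linarith)
        rw [abs_of_nonneg m0, abs_of_nonpos (by linarith : (S (B - 1) + S B) / 2 ≤ 0), abs_of_nonpos s0, abs_of_nonpos s1]
        constructor
        · ring
        · have : min (-S (B - 1)) (-S B) ≤ -S B := min_le_right _ _
          linarith [hSmono B]
      · have m0 := hneg B (by linarith)
        have s0 := Sge (B - 1) (by linarith)
        have s1 := Sge B (by linarith)
        rw [abs_of_nonpos m0, abs_of_nonneg (by linarith : 0 ≤ (S (B - 1) + S B) / 2), abs_of_nonneg s0, abs_of_nonneg s1]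
        constructor
        · ring
        · have : min (S (B - 1)) (S B) ≤ S (B - 1) := min_le_left _ _
          linarith [hSmono B]
    obtain ⟨k1, k2⟩ := key
    have habs0 : 0 ≤ |m B| := abs_nonneg _
    have hc := hcurv B hBlo hBhi
    have k3 : 2 * θ * |m B| * min |S (B - 1)| |S B| ≤ 2 * θ * |m B| * |(S (B - 1) + S B) / 2| :=
      mul_le_mul_of_nonneg_left k2 (by positivity)
    rw [hq B] at three
    nlinarith [three, hQ, k1, k3, hc, habs0, abs_nonneg ((S (B - 1) + S B) / 2)]
  -- the bracket contains `g(B₁)` and `g(B₂ − 1) ≥ g(B₂)`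
  have hbr : (m B₁ - m (B₁ + 1)) + (m B₂ - m (B₂ + 1)) ≤ 2 * (m B₁ - m B₂) := by
    have a1 : m B₂ ≤ m (B₁ + 1) := int_chain_le (f := m) hg0 (by linarith) (by linarith) (by linarith)
    have a2 : m B₂ - m (B₂ + 1) ≤ m (B₂ - 1) - m (B₂ - 1 + 1) := by
      have := hga (B₂ - 1) (by linarith) (by linarith)
      rw [show B₂ - 1 + 1 + 1 = B₂ + 1 by ring, show B₂ - 1 + 1 = B₂ by ring] at this
      rw [show B₂ - 1 + 1 = B₂ by ring]; exact this
    have a3 : m (B₂ - 1 + 1) = m B₂ := by rw [sub_add_cancel]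
    have a4 : m (B₂ - 1) ≤ m B₁ := int_chain_le (f := m) hg0 hlo (by linarith) (by linarith)
    rw [a3] at a2
    linarith
  have p1 := point B₁ hlo (by linarith)
  have p2 := point B₂ (by linarith) hhi
  have g1 : 0 ≤ m B₁ - m (B₁ + 1) := by linarith [hg0 B₁ hlo (by linarith)]
  have g2 : 0 ≤ m B₂ - m (B₂ + 1) := by linarith [hg0 B₂ (by linarith) hhi]
  nlinarith [p1, p2, hbr, g1, g2, hlam0]

/-! ## §5 The per-copy form of the drift inequality -/

/-- Sum of gaps over a window is at least the number of gaps times the last one (gaps non-increasing): `(B₂ − B₁)·g(B₂−1) ≤ f(B₁) − f(B₂)`. [ours] -/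
theorem int_gap_sum_ge {f : ℤ → ℝ} {lo hi : ℤ} (hga : ∀ B, lo ≤ B → B + 1 ≤ hi → f (B + 1) - f (B + 1 + 1) ≤ f B - f (B + 1))
    {B₁ B₂ : ℤ} (hlo : lo ≤ B₁) (h12 : B₁ < B₂) (hhi : B₂ ≤ hi) :
    ((B₂ : ℝ) - B₁) * (f (B₂ - 1) - f B₂) ≤ f B₁ - f B₂ := by
  obtain ⟨n, rfl⟩ : ∃ n : ℕ, B₂ = B₁ + 1 + n := ⟨(B₂ - B₁ - 1).toNat, by rw [Int.toNat_of_nonneg (by linarith)]; ring⟩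
  induction n with
  | zero => push_cast; rw [show B₁ + 1 + (0 : ℤ) - 1 = B₁ by ring, show B₁ + 1 + (0 : ℤ) = B₁ + 1 by ring]; ring_nf; linarith
  | succ k ih =>
    have hk : B₁ + 1 + (k : ℕ) ≤ hi := by push_cast at hhi ⊢; linarith
    have ih' := ih (by linarith) hk
    have step := hga (B₁ + k) (by linarith) (by push_cast at hhi; linarith)
    push_cast at ih' step hhi ⊢
    rw [show B₁ + 1 + (k : ℤ) - 1 = B₁ + k by ring] at ih'
    rw [show B₁ + 1 + ((k : ℤ) + 1) - 1 = B₁ + k + 1 by ring, show B₁ + 1 + ((k : ℤ) + 1) = B₁ + k + 1 + 1 by ring]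
    rw [show B₁ + 1 + (k : ℤ) = B₁ + k + 1 by ring] at ih'
    have hk0 : (0 : ℝ) ≤ k + 1 := by positivity
    nlinarith [ih', step, hk0]

/-- **THE PER-COPY FORM OF THE DRIFT INEQUALITY (Plan A).**  In the setting of `oneCopy_curvature_le_bracket` with `θ = λ ≤ 1`, `φ(B+1) − φ(B) = S(B)`, `φ(B₀) = 0`,
suppose on the window: (D1) the drift grows at least linearly away from a point `B* ∈ [B₀, B₀+1]` (its real zero), `2ρ|B − B*| ≤ (1−λ)|m(B)|`; (D2) wherever the slope is not
saturated the local gap is still large: `ρ(1 − S(B−1)) ≤ (1−λ)(m(B) − m(B+1))` above the bottom and `ρ(1 + S(B−1)) ≤ (1−λ)(m(B−1) − m(B))` at and below it.  THEN for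
all `lo ≤ B₁ < B₂ ≤ hi`: **`ρ((B₂ − B₁) + φ(B₁) + φ(B₂)) ≤ [m(B₁) − m(B₂)] + d(B₁) + d(B₂)`** — the drift inequality of S9 (`oneCopy_bracket_eq_drift_sub`).
Straddling pairs use (D1) only (`φ(B) ≤ |B − B*|·|s̄(B)|` by convexity); same-side pairs use (D2) for the far copy's unsaturated slope. [ours] -/
theorem oneCopyDrift_of_driftPotential {m qd qu S φ : ℤ → ℝ} {B₀ lo hi : ℤ} {lam ρ Bs : ℝ} (hlam0 : 0 ≤ lam) (hlam1 : lam ≤ 1) (hρ : 0 ≤ ρ)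
    (hBs0 : (B₀ : ℝ) ≤ Bs) (hBs1 : Bs ≤ B₀ + 1)
    (hq : ∀ B, qd B - qu B = -m B) (hq1 : ∀ B, qd B + qu B ≤ 1)
    (hg0 : ∀ B, lo ≤ B → B ≤ hi → m (B + 1) ≤ m B)
    (hga : ∀ B, lo ≤ B → B + 1 ≤ hi → m (B + 1) - m (B + 1 + 1) ≤ m B - m (B + 1))
    (hpos : ∀ B, B ≤ B₀ → 0 ≤ m B) (hneg : ∀ B, B₀ + 1 ≤ B → m B ≤ 0)
    (hφS : ∀ B, φ (B + 1) - φ B = S B) (hφ0 : φ B₀ = 0)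
    (hS0 : S B₀ = 0) (hSmono : ∀ B, S (B - 1) ≤ S B)
    (hcurv : ∀ B, lo ≤ B → B ≤ hi → S B - S (B - 1) ≤ lam * (m B - m (B + 1)) + 2 * lam * |m B| * min |S (B - 1)| |S B|)
    (D1 : ∀ B, lo ≤ B → B ≤ hi → 2 * ρ * |(B : ℝ) - Bs| ≤ (1 - lam) * |m B|)
    (D2a : ∀ B, B₀ + 1 ≤ B → B ≤ hi → ρ * (1 - S (B - 1)) ≤ (1 - lam) * (m B - m (B + 1)))
    (D2b : ∀ B, lo ≤ B → B ≤ B₀ → ρ * (1 + S (B - 1)) ≤ (1 - lam) * (m (B - 1) - m B))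
    (B₁ B₂ : ℤ) (hlo : lo ≤ B₁) (h12 : B₁ < B₂) (hhi : B₂ ≤ hi) :
    ρ * (((B₂ : ℝ) - B₁) + φ B₁ + φ B₂)
      ≤ (m B₁ - m B₂) + (qd B₁ * (φ B₁ - φ (B₁ - 1)) - qu B₁ * (φ (B₁ + 1) - φ B₁))
        + (qd B₂ * (φ B₂ - φ (B₂ - 1)) - qu B₂ * (φ (B₂ + 1) - φ B₂)) := by
  have hSmono' : Monotone S := monotone_int_of_le_succ (fun B => by simpa using hSmono (B + 1))
  have Sge : ∀ B, B₀ ≤ B → 0 ≤ S B := fun B hB => by rw [← hS0]; exact hSmono' hB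
  have Sle : ∀ B, B ≤ B₀ → S B ≤ 0 := fun B hB => by rw [← hS0]; exact hSmono' hB
  have eS : ∀ B, φ B - φ (B - 1) = S (B - 1) := fun B => by have := hφS (B - 1); rw [sub_add_cancel] at this; exact this
  rw [eS B₁, eS B₂, hφS B₁, hφS B₂]
  have base := oneCopy_curvature_le_bracket (lo := lo) (hi := hi) hlam0 hlam0 hq hq1 hg0 hga hpos hneg hS0 hSmono hcurv B₁ B₂ hlo h12 hhi
  have h1l : 0 ≤ 1 - lam := by linarith
  have h12r : (B₁ : ℝ) + 1 ≤ B₂ := by exact_mod_cast h12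
  -- convexity bounds on `φ`
  have φabove : ∀ n : ℕ, φ (B₀ + 1 + n) ≤ n * S (B₀ + n) := by
    intro n
    induction n with
    | zero => have := hφS B₀; rw [hS0] at this; simp; linarith
    | succ k ih =>
      have e := hφS (B₀ + 1 + k)
      have mono := hSmono (B₀ + 1 + k)
      push_cast
      rw [show B₀ + 1 + ((k : ℤ) + 1) = B₀ + 1 + k + 1 by ring, show B₀ + ((k : ℤ) + 1) = B₀ + 1 + k by ring]
      rw [show B₀ + 1 + (k : ℤ) - 1 = B₀ + k by ring] at mono
      have hk0 : (0 : ℝ) ≤ k := Nat.cast_nonneg _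
      nlinarith [ih, mono, e, hk0]
  have φbelow : ∀ n : ℕ, φ (B₀ - n) ≤ n * (-S (B₀ - n)) := by
    intro n
    induction n with
    | zero => simp [hφ0]
    | succ k ih =>
      have e := hφS (B₀ - (k + 1))
      have mono := hSmono (B₀ - k)
      push_cast
      rw [show B₀ - ((k : ℤ) + 1) + 1 = B₀ - k by ring] at e
      rw [show B₀ - (k : ℤ) - 1 = B₀ - (k + 1) by ring] at mono
      have hk0 : (0 : ℝ) ≤ k := Nat.cast_nonneg _
      nlinarith [ih, mono, e, hk0]
  have φA : ∀ B, B₀ + 1 ≤ B → φ B ≤ ((B : ℝ) - B₀ - 1) * S (B - 1) := by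
    intro B hB
    obtain ⟨n, rfl⟩ : ∃ n : ℕ, B = B₀ + 1 + n := ⟨(B - B₀ - 1).toNat, by rw [Int.toNat_of_nonneg (by linarith)]; ring⟩
    have := φabove n
    push_cast
    rw [show B₀ + 1 + (n : ℤ) - 1 = B₀ + n by ring, show ((B₀ : ℝ) + 1 + n - B₀ - 1) = n by ring]
    exact this
  have φB : ∀ B, B ≤ B₀ → φ B ≤ ((B₀ : ℝ) - B) * (-S B) := by
    intro B hB
    obtain ⟨n, rfl⟩ : ∃ n : ℕ, B = B₀ - n := ⟨(B₀ - B).toNat, by rw [Int.toNat_of_nonneg (by linarith)]; ring⟩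
    have := φbelow n
    push_cast
    rw [show ((B₀ : ℝ) - (B₀ - n)) = n by ring]
    exact this
  rcases le_or_gt B₂ B₀ with h2 | h2
  · ---------------------------------------------------------------- both at or below the bottom
    have h1 : B₁ ≤ B₀ := by linarith
    have h1r : (B₁ : ℝ) ≤ B₀ := by exact_mod_cast h1
    have h2r : (B₂ : ℝ) ≤ B₀ := by exact_mod_cast h2
    have m1 := hpos B₁ h1; have m2 := hpos B₂ h2
    have s1a := Sle (B₁ - 1) (by linarith); have s1b := Sle B₁ h1
    have s2a := Sle (B₂ - 1) (by linarith); have s2b := Sle B₂ h2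
    rw [abs_of_nonneg m1, abs_of_nonneg m2, abs_of_nonpos (by linarith : (S (B₁ - 1) + S B₁) / 2 ≤ 0),
      abs_of_nonpos (by linarith : (S (B₂ - 1) + S B₂) / 2 ≤ 0)] at base
    have d1 := D1 B₁ hlo (by linarith); have d2 := D1 B₂ (by linarith) hhi
    rw [abs_of_nonneg m1, abs_of_nonpos (by linarith)] at d1
    rw [abs_of_nonneg m2, abs_of_nonpos (by linarith)] at d2
    have f1 := φB B₁ h1
    have f2 := φB B₂ h2
    have gs := int_gap_sum_ge (f := m) hga hlo h12 hhi
    have dd := D2b B₂ (by linarith) h2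
    have smon : S B₁ ≤ S (B₂ - 1) := hSmono' (by linarith)
    -- products
    have u1 : ρ * φ B₁ ≤ ρ * ((Bs - (B₁ : ℝ)) * (-((S (B₁ - 1) + S B₁) / 2))) := by
      apply mul_le_mul_of_nonneg_left _ hρ
      calc φ B₁ ≤ ((B₀ : ℝ) - B₁) * (-S B₁) := f1
        _ ≤ (Bs - (B₁ : ℝ)) * (-S B₁) := mul_le_mul_of_nonneg_right (by linarith) (by linarith)
        _ ≤ (Bs - (B₁ : ℝ)) * (-((S (B₁ - 1) + S B₁) / 2)) := mul_le_mul_of_nonneg_left (by linarith [hSmono B₁]) (by linarith)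
    have u2 : ρ * φ B₂ ≤ ρ * ((Bs - (B₂ : ℝ)) * (-((S (B₂ - 1) + S B₂) / 2))) := by
      apply mul_le_mul_of_nonneg_left _ hρ
      calc φ B₂ ≤ ((B₀ : ℝ) - B₂) * (-S B₂) := f2
        _ ≤ (Bs - (B₂ : ℝ)) * (-S B₂) := mul_le_mul_of_nonneg_right (by linarith) (by linarith)
        _ ≤ (Bs - (B₂ : ℝ)) * (-((S (B₂ - 1) + S B₂) / 2)) := mul_le_mul_of_nonneg_left (by linarith [hSmono B₂]) (by linarith)
    have v1 := mul_le_mul_of_nonneg_right d1 (by linarith : 0 ≤ -((S (B₁ - 1) + S B₁) / 2))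
    have v2 := mul_le_mul_of_nonneg_right d2 (by linarith : 0 ≤ -((S (B₂ - 1) + S B₂) / 2))
    -- far copy `B₁`: `ρ(B₀ + 1/2 − B₁)|s̄₁| ≥ ρ(B₂ − B₁)(−S B₁)`
    have w1 : ρ * (((B₂ : ℝ) - B₁) * (-S B₁)) ≤ ρ * ((Bs - (B₁ : ℝ)) * (-((S (B₁ - 1) + S B₁) / 2))) := by
      apply mul_le_mul_of_nonneg_left _ hρ
      calc ((B₂ : ℝ) - B₁) * (-S B₁) ≤ (Bs - (B₁ : ℝ)) * (-S B₁) := mul_le_mul_of_nonneg_right (by linarith) (by linarith)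
        _ ≤ _ := mul_le_mul_of_nonneg_left (by linarith [hSmono B₁]) (by linarith)
    -- bracket: `(1−λ)(m₁ − m₂) ≥ (B₂ − B₁)(1−λ)g(B₂−1) ≥ (B₂ − B₁)ρ(1 + S(B₂−1)) ≥ (B₂ − B₁)ρ(1 + S B₁)`
    have x1 := mul_le_mul_of_nonneg_left gs h1l
    have x2 : ((B₂ : ℝ) - B₁) * (ρ * (1 + S B₁)) ≤ ((B₂ : ℝ) - B₁) * ((1 - lam) * (m (B₂ - 1) - m B₂)) := by
      apply mul_le_mul_of_nonneg_left _ (by linarith only [h12r])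
      have : ρ * (1 + S B₁) ≤ ρ * (1 + S (B₂ - 1)) := mul_le_mul_of_nonneg_left (by linarith only [smon]) hρ
      linarith only [this, dd]
    have nn : 0 ≤ (1 - lam) * (m B₂ * (-((S (B₂ - 1) + S B₂) / 2))) := mul_nonneg h1l (mul_nonneg m2 (by linarith))
    linarith only [base, u1, u2, v1, v2, w1, x1, x2, nn]
  rcases le_or_gt B₁ B₀ with h1 | h1
  · ---------------------------------------------------------------- straddling: `B₁ ≤ B₀ < B₂`
    have h1r : (B₁ : ℝ) ≤ B₀ := by exact_mod_cast h1
    have h2' : B₀ + 1 ≤ B₂ := by linarith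
    have h2r : (B₀ : ℝ) + 1 ≤ B₂ := by exact_mod_cast h2'
    have m1 := hpos B₁ h1; have m2 := hneg B₂ h2'
    have s1a := Sle (B₁ - 1) (by linarith); have s1b := Sle B₁ h1
    have s2a := Sge (B₂ - 1) (by linarith); have s2b := Sge B₂ (by linarith)
    rw [abs_of_nonneg m1, abs_of_nonpos m2, abs_of_nonpos (by linarith : (S (B₁ - 1) + S B₁) / 2 ≤ 0),
      abs_of_nonneg (by linarith : 0 ≤ (S (B₂ - 1) + S B₂) / 2)] at base
    have d1 := D1 B₁ hlo (by linarith); have d2 := D1 B₂ (by linarith) hhi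
    rw [abs_of_nonneg m1, abs_of_nonpos (by linarith)] at d1
    rw [abs_of_nonpos m2, abs_of_nonneg (by linarith)] at d2
    have f1 := φB B₁ h1
    have f2 := φA B₂ h2'
    have u1 : ρ * φ B₁ ≤ ρ * ((Bs - (B₁ : ℝ)) * (-((S (B₁ - 1) + S B₁) / 2))) := by
      apply mul_le_mul_of_nonneg_left _ hρ
      calc φ B₁ ≤ ((B₀ : ℝ) - B₁) * (-S B₁) := f1
        _ ≤ (Bs - (B₁ : ℝ)) * (-S B₁) := mul_le_mul_of_nonneg_right (by linarith) (by linarith)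
        _ ≤ _ := mul_le_mul_of_nonneg_left (by linarith [hSmono B₁]) (by linarith)
    have u2 : ρ * φ B₂ ≤ ρ * (((B₂ : ℝ) - Bs) * ((S (B₂ - 1) + S B₂) / 2)) := by
      apply mul_le_mul_of_nonneg_left _ hρ
      calc φ B₂ ≤ ((B₂ : ℝ) - B₀ - 1) * S (B₂ - 1) := f2
        _ ≤ ((B₂ : ℝ) - Bs) * S (B₂ - 1) := mul_le_mul_of_nonneg_right (by linarith) s2a
        _ ≤ _ := mul_le_mul_of_nonneg_left (by linarith [hSmono B₂]) (by linarith)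
    have v1 := mul_le_mul_of_nonneg_right d1 (by linarith : 0 ≤ -((S (B₁ - 1) + S B₁) / 2))
    have v2 := mul_le_mul_of_nonneg_right d2 (by linarith : 0 ≤ (S (B₂ - 1) + S B₂) / 2)
    have nn1 : 0 ≤ (1 - lam) * (m B₁ * (-((S (B₁ - 1) + S B₁) / 2))) := mul_nonneg h1l (mul_nonneg m1 (by linarith))
    have nn2 : 0 ≤ (1 - lam) * (-m B₂ * ((S (B₂ - 1) + S B₂) / 2)) := mul_nonneg h1l (mul_nonneg (by linarith) (by linarith))
    have nn3 : 0 ≤ ρ * ((B₂ : ℝ) - B₁) := mul_nonneg hρ (by linarith)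
    linarith only [base, u1, u2, v1, v2, d1, d2, nn1, nn2, nn3]
  · ---------------------------------------------------------------- both above the bottom: `B₀ + 1 ≤ B₁ < B₂`
    have h1' : B₀ + 1 ≤ B₁ := by linarith
    have h1r : (B₀ : ℝ) + 1 ≤ B₁ := by exact_mod_cast h1'
    have m1 := hneg B₁ h1'; have m2 := hneg B₂ (by linarith)
    have s1a := Sge (B₁ - 1) (by linarith); have s1b := Sge B₁ (by linarith)
    have s2a := Sge (B₂ - 1) (by linarith); have s2b := Sge B₂ (by linarith)
    rw [abs_of_nonpos m1, abs_of_nonpos m2, abs_of_nonneg (by linarith : 0 ≤ (S (B₁ - 1) + S B₁) / 2),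
      abs_of_nonneg (by linarith : 0 ≤ (S (B₂ - 1) + S B₂) / 2)] at base
    have d1 := D1 B₁ hlo (by linarith); have d2 := D1 B₂ (by linarith) hhi
    rw [abs_of_nonpos m1, abs_of_nonneg (by linarith)] at d1
    rw [abs_of_nonpos m2, abs_of_nonneg (by linarith)] at d2
    have f1 := φA B₁ h1'
    have f2 := φA B₂ (by linarith)
    have gs := int_gap_sum_ge (f := m) hga hlo h12 hhi
    have dd := D2a (B₂ - 1) (by linarith) (by linarith)
    rw [show B₂ - 1 - 1 = B₂ - 2 by ring, show B₂ - 1 + 1 = B₂ by ring] at dd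
    have smon : S (B₂ - 2) ≤ S (B₂ - 1) := by have := hSmono (B₂ - 1); rw [show B₂ - 1 - 1 = B₂ - 2 by ring] at this; exact this
    have u1 : ρ * φ B₁ ≤ ρ * (((B₁ : ℝ) - Bs) * ((S (B₁ - 1) + S B₁) / 2)) := by
      apply mul_le_mul_of_nonneg_left _ hρ
      calc φ B₁ ≤ ((B₁ : ℝ) - B₀ - 1) * S (B₁ - 1) := f1
        _ ≤ ((B₁ : ℝ) - Bs) * S (B₁ - 1) := mul_le_mul_of_nonneg_right (by linarith) s1a
        _ ≤ _ := mul_le_mul_of_nonneg_left (by linarith [hSmono B₁]) (by linarith)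
    have u2 : ρ * φ B₂ ≤ ρ * (((B₂ : ℝ) - Bs) * ((S (B₂ - 1) + S B₂) / 2)) := by
      apply mul_le_mul_of_nonneg_left _ hρ
      calc φ B₂ ≤ ((B₂ : ℝ) - B₀ - 1) * S (B₂ - 1) := f2
        _ ≤ ((B₂ : ℝ) - Bs) * S (B₂ - 1) := mul_le_mul_of_nonneg_right (by linarith) s2a
        _ ≤ _ := mul_le_mul_of_nonneg_left (by linarith [hSmono B₂]) (by linarith)
    have v1 := mul_le_mul_of_nonneg_right d1 (by linarith : 0 ≤ (S (B₁ - 1) + S B₁) / 2)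
    have v2 := mul_le_mul_of_nonneg_right d2 (by linarith : 0 ≤ (S (B₂ - 1) + S B₂) / 2)
    -- far copy `B₂`: `ρ(B₂ − B₀ − 1/2)s̄₂ ≥ ρ(B₂ − B₁)S(B₂−1)`
    have w2 : ρ * (((B₂ : ℝ) - B₁) * S (B₂ - 1)) ≤ ρ * (((B₂ : ℝ) - Bs) * ((S (B₂ - 1) + S B₂) / 2)) := by
      apply mul_le_mul_of_nonneg_left _ hρ
      calc ((B₂ : ℝ) - B₁) * S (B₂ - 1) ≤ ((B₂ : ℝ) - Bs) * S (B₂ - 1) := mul_le_mul_of_nonneg_right (by linarith) s2a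
        _ ≤ _ := mul_le_mul_of_nonneg_left (by linarith [hSmono B₂]) (by linarith)
    have x1 := mul_le_mul_of_nonneg_left gs h1l
    have x2 : ((B₂ : ℝ) - B₁) * (ρ * (1 - S (B₂ - 1))) ≤ ((B₂ : ℝ) - B₁) * ((1 - lam) * (m (B₂ - 1) - m B₂)) := by
      apply mul_le_mul_of_nonneg_left _ (by linarith only [h12r])
      have : ρ * (1 - S (B₂ - 1)) ≤ ρ * (1 - S (B₂ - 2)) := mul_le_mul_of_nonneg_left (by linarith only [smon]) hρ
      linarith only [this, dd]
    have nn : 0 ≤ (1 - lam) * (-m B₁ * ((S (B₁ - 1) + S B₁) / 2)) := mul_nonneg h1l (mul_nonneg (by linarith) (by linarith))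
    linarith only [base, u1, u2, v1, v2, w2, x1, x2, nn]

end Summit.Ventures.LatticeQCDFlow.Scaling

end
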